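import Summits.QuantumFields.GaugeBoot.PlanarCertificateSoundnessZd
import Mathlib.Analysis.SpecialFunctions.Sqrt
import HarnessLib

/-!
# Planar certificates are asymptotic bounds as `N → ∞` GIVEN concentration of the imaginary parts of their loops (gauge-boot, large-`N` supplement 5 — the CONDITIONAL header of T5-COND, as a theorem)

HONEST FRAMING (cell `pub-gaugeboot`, page 1 of every file): the venture produces certified bounds
on lattice expectations at stated coupling, gauge group, dimension and torus size; NOT a mass gap,
NOT a continuum limit, NOT a string tension; NOT large `N` unless marked CONDITIONAL; NOT
Yang–Mills-summit-bearing (barriers `FixedCouplingUltralocality`, `PerturbativeInvisibility`).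
This file states EXACTLY what "CONDITIONAL (planar)" must mean for a planar bootstrap number; it
certifies no number and assumes no factorisation theorem (sequel: the strong-coupling discharge).

## Content

Fix a valid planar certificate `P` (`PlanarCertificateSoundnessZd`) at 't Hooft coupling `βt`, a
base point `x`, and for every `N ≥ 1` a probability Haar-shift state `μ_N` of the `SU(N)` (resp.
`U(N)`) Wilson action on `ℤ^d` at tree coupling `N·βt` (DLR states, torus thermodynamic limit
points, Class-B states all qualify) satisfying the certificate's identification rows.  Supplement 4
gives, for every `N`, `obj(W_{μ_N}) ≤ bound + D_N` with the defect `D_N` a finite combination of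
`length/N²` and of imaginary-part covariances `Γ_{μ_N}`.  Here:

* `tendsto_shorDefect_zero` — if `E_{μ_N}[(Im t_{ℓ_A})²] → 0` for the loops of the relaxation block,
  every relaxation defect `γ_s(μ_N) → 0` (any family of compact groups `G_N`);
* `tendsto_rowDefectSuN_zero` — if `E_{μ_N}[(Im t_{w_r})²] → 0` for the marked words, every `SU(N)`
  row defect `ε_r(μ_N) → 0` (`Γ(w, P̃)² ≤ Γ(w, w)`, `length/N² → 0`);
* ★★★ `PlanarCertificate.eventually_obj_le_suN` / `…_uN` — **THE CONDITIONAL LARGE-`N` THEOREM: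
  if the imaginary parts of the finitely many loop variables named by the certificate concentrate,
  `E_{μ_N}[(Im tr hol(C)/N)²] → 0` (a consequence of large-`N` factorisation of `|t_C|²` together
  with reality of `E t_C`), then for every `δ > 0`, `obj(W_{μ_N}) ≤ bound + δ` for all large `N`**;
  ★★ `PlanarCertificate.le_bound_of_tendsto_suN` / `…_uN`: any limit of `obj(W_{μ_N})` is `≤ bound`.

Lower bounds are the case `obj ↦ −obj`.  What is NOT claimed: that the imaginary parts concentrate at
any given `βt` (that is the CONDITION; discharged at strong coupling from Shen–Zhu–Zhu in the
sequel), any rate in `N`, anything about `SU(∞)` as an object.  [folklore] analysis;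
Kazakov–Zheng arXiv:2203.11360 for the planar SDP.
-/

noncomputable section

open MeasureTheory Filter Topology
open scoped BigOperators
open Literature.Probability.LatticeModels (Site)
open Literature.MathematicalPhysics.QuantumLattice

namespace Summit.QuantumFields.GaugeBoot

variable {d : ℕ}

/-! ## Elementary limits -/

/-- `C/N² → 0`. [folklore] -/
theorem tendsto_const_div_natCast_sq (C : ℝ) : Tendsto (fun N : ℕ => C / (N : ℝ) ^ 2) atTop (𝓝 0) := by
  have h1 : Tendsto (fun N : ℕ => C / (N : ℝ)) atTop (𝓝 0) := tendsto_const_div_atTop_nhds_zero_nat C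
  have h2 : Tendsto (fun N : ℕ => ((N : ℝ))⁻¹) atTop (𝓝 0) := tendsto_inv_atTop_zero.comp tendsto_natCast_atTop_atTop
  have h := h1.mul h2
  rw [zero_mul] at h
  refine h.congr fun N => ?_
  rw [sq, div_mul_eq_div_div, div_eq_mul_inv (C / N)]

/-- If `a_N² ≤ b_N` eventually and `b_N → 0` then `a_N → 0`. [folklore] -/
theorem tendsto_zero_of_sq_le {a b : ℕ → ℝ} (hb : Tendsto b atTop (𝓝 0)) (hab : ∀ᶠ N in atTop, a N ^ 2 ≤ b N) :
    Tendsto a atTop (𝓝 0) := by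
  have habs : Tendsto (fun N => |a N|) atTop (𝓝 0) := by
    have hs : Tendsto (fun N => Real.sqrt (b N)) atTop (𝓝 0) := by
      have := hb.sqrt; rwa [Real.sqrt_zero] at this
    refine tendsto_of_tendsto_of_tendsto_of_le_of_le' tendsto_const_nhds hs
      (Eventually.of_forall fun N => abs_nonneg _) ?_
    filter_upwards [hab] with N hN
    rw [← Real.sqrt_sq_eq_abs]
    exact Real.sqrt_le_sqrt hN
  exact (tendsto_zero_iff_abs_tendsto_zero a).2 habs

/-! ## The defects vanish under concentration of the imaginary parts -/

section Defects

variable {G : ℕ → Type*} [∀ N, Group (G N)] [∀ N, TopologicalSpace (G N)] [∀ N, IsTopologicalGroup (G N)]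
  [∀ N, CompactSpace (G N)] [∀ N, MeasurableSpace (G N)] [∀ N, BorelSpace (G N)]
  (ρ : (N : ℕ) → (G N →* Matrix (Fin N) (Fin N) ℂ))

/-- **Mixed imaginary-part covariances vanish when the diagonal ones do**: if
`E_{μ_N}[(Im t_A)²] → 0` then `E_{μ_N}[Im t_A Im t_B] → 0` for every `B` (`Γ(A,B)² ≤ Γ(A,A)`). [folklore] -/
theorem tendsto_loopImCov_zero (hρ : ∀ N, Continuous (ρ N)) (μ : (N : ℕ) → Measure (LGConfig d (G N)))
    (hprob : ∀ᶠ N in atTop, IsProbabilityMeasure (μ N)) (x : Site d) (A B : Word d)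
    (hA : Tendsto (fun N => loopImCov (ρ N) (μ N) x A A) atTop (𝓝 0)) :
    Tendsto (fun N => loopImCov (ρ N) (μ N) x A B) atTop (𝓝 0) := by
  refine tendsto_zero_of_sq_le hA ?_
  filter_upwards [hprob] with N hN
  exact sq_loopImCov_le (ρ N) (hρ N) (μ N) x A B

/-- **The relaxation defects vanish**: for a planar certificate `P`, if `E_{μ_N}[(Im t_{ℓ_A})²] → 0`
for every loop `ℓ_A` of its relaxation block, then `γ_s(μ_N) → 0` for every factor `s`. [folklore] -/
theorem tendsto_shorDefect_zero (hρ : ∀ N, Continuous (ρ N)) (μ : (N : ℕ) → Measure (LGConfig d (G N)))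
    (P : PlanarCertificate d) (hprob : ∀ᶠ N in atTop, IsProbabilityMeasure (μ N))
    (x : Site d) (hIm : ∀ A, Tendsto (fun N => loopImCov (ρ N) (μ N) x (P.shorLoop A) (P.shorLoop A)) atTop (𝓝 0))
    (s : Fin P.nS) : Tendsto (fun N => P.shorDefect (ρ N) (μ N) x s) atTop (𝓝 0) := by
  have hup : Tendsto (fun N => (P.nI : ℝ) * ∑ A, P.shorVec s A ^ 2 * loopImCov (ρ N) (μ N) x (P.shorLoop A) (P.shorLoop A))
      atTop (𝓝 0) := by
    have h : Tendsto (fun N => ∑ A, P.shorVec s A ^ 2 * loopImCov (ρ N) (μ N) x (P.shorLoop A) (P.shorLoop A))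
        atTop (𝓝 (∑ A : Fin P.nI, P.shorVec s A ^ 2 * 0)) :=
      tendsto_finsetSum _ fun A _ => (hIm A).const_mul _
    simp only [mul_zero, Finset.sum_const_zero] at h
    simpa using h.const_mul (P.nI : ℝ)
  refine tendsto_of_tendsto_of_tendsto_of_le_of_le' tendsto_const_nhds hup
    (Eventually.of_forall fun N => P.shorDefect_nonneg (ρ N) (μ N) x s) ?_
  filter_upwards [hprob] with N hN
  exact P.shorDefect_le_card (ρ N) (hρ N) (μ N) x s

end Defects

/-- **The `SU(N)` row defects vanish**: if `E_{μ_N}[(Im t_{w_r})²] → 0` for the marked word of row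
`r`, then `ε_r(μ_N) = length(w_r)/N² + |βt| Σ_{ν,ε} |Γ_{μ_N}(w_r, P̃_{ν,ε})| → 0`. [folklore] -/
theorem tendsto_rowDefectSuN_zero (P : PlanarCertificate d)
    (μ : (N : ℕ) → Measure (LGConfig d (Matrix.specialUnitaryGroup (Fin N) ℂ)))
    (hprob : ∀ᶠ N in atTop, IsProbabilityMeasure (μ N)) (x : Site d) (r : Fin P.nR)
    (hIm : Tendsto (fun N => loopImCov (fundamentalRep (Fin N)) (μ N) x (P.rowWord r) (P.rowWord r)) atTop (𝓝 0)) :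
    Tendsto (fun N => P.rowDefectSuN (μ N) x r) atTop (𝓝 0) := by
  have h1 : Tendsto (fun N : ℕ => ((P.rowWord r).length : ℝ) / (N : ℝ) ^ 2) atTop (𝓝 0) :=
    tendsto_const_div_natCast_sq _
  have h2 : ∀ ν ε, Tendsto (fun N => |loopImCov (fundamentalRep (Fin N)) (μ N) x (P.rowWord r)
      (plaqWord (P.rowAxis r) ν ε)|) atTop (𝓝 0) := fun ν ε => by
    have h := tendsto_loopImCov_zero (fun N => fundamentalRep (Fin N)) (fun N => continuous_fundamentalRep (Fin N)) μ
      hprob x (P.rowWord r) (plaqWord (P.rowAxis r) ν ε) hIm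
    have := (tendsto_zero_iff_abs_tendsto_zero _).1 h
    exact this
  have h3 : Tendsto (fun N => |P.βt| * ∑ ν ∈ Finset.univ.erase (P.rowAxis r), ∑ ε : Bool,
      |loopImCov (fundamentalRep (Fin N)) (μ N) x (P.rowWord r) (plaqWord (P.rowAxis r) ν ε)|) atTop (𝓝 0) := by
    have h : Tendsto (fun N => ∑ ν ∈ Finset.univ.erase (P.rowAxis r), ∑ ε : Bool,
        |loopImCov (fundamentalRep (Fin N)) (μ N) x (P.rowWord r) (plaqWord (P.rowAxis r) ν ε)|) atTop
        (𝓝 (∑ ν ∈ Finset.univ.erase (P.rowAxis r), ∑ ε : Bool, (0 : ℝ))) :=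
      tendsto_finsetSum _ fun ν _ => tendsto_finsetSum _ fun ε _ => h2 ν ε
    simp only [Finset.sum_const_zero] at h
    simpa using h.const_mul |P.βt|
  have h := h1.add h3
  rw [add_zero] at h
  exact h

/-! ## The conditional large-`N` theorem -/

namespace PlanarCertificate

variable (P : PlanarCertificate d)

/-- `(N·βt)/N = βt` for `N ≥ 1`. [folklore] -/
theorem natCast_mul_div_natCast {N : ℕ} (hN : 1 ≤ N) (βt : ℝ) : (N : ℝ) * βt / N = βt := by
  have : (N : ℝ) ≠ 0 := by exact_mod_cast (Nat.one_le_iff_ne_zero.1 hN)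
  field_simp

/-- ★★★ **THE CONDITIONAL LARGE-`N` THEOREM, `SU(N)`.**  Let `P` be a valid planar certificate at
't Hooft coupling `βt`, and for every `N ≥ 1` let `μ_N` be a probability Haar-shift state of the
`SU(N)` Wilson action on `ℤ^d` at tree coupling `N·βt` (e.g. a DLR state, a torus thermodynamic
limit point, a Class-B state) satisfying the certificate's identification rows, all words closed at
`x`.  IF the imaginary parts of the certificate's loop variables concentrate —
`E_{μ_N}[(Im tr hol(C)/N)²] → 0` for the relaxation loops `C = ℓ_A` and the marked words `C = w_r`
— THEN for every `δ > 0`: `obj(W_{μ_N}) ≤ bound + δ` for all sufficiently large `N`. [folklore] -/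
theorem eventually_obj_le_suN (hP : P.IsValid)
    (μ : (N : ℕ) → Measure (LGConfig d (Matrix.specialUnitaryGroup (Fin N) ℂ)))
    (hprob : ∀ N, 1 ≤ N → IsProbabilityMeasure (μ N))
    (hμ : ∀ N, 1 ≤ N → IsHaarShiftState (fundamentalRep (Fin N)) ((N : ℝ) * P.βt) (μ N)) (x : Site d)
    (hrow : ∀ r, Word.endpointZd x (P.rowWord r) = x) (hgram : ∀ j i, Word.endpointZd x (P.gramWord j i) = x)
    (hlin : ∀ N, 1 ≤ N → ∀ e, P.lin e (loopW (fundamentalRep (Fin N)) (μ N) x) (loopQ (fundamentalRep (Fin N)) (μ N) x) = 0)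
    (hImShor : ∀ A, Tendsto (fun N => loopImCov (fundamentalRep (Fin N)) (μ N) x (P.shorLoop A) (P.shorLoop A)) atTop (𝓝 0))
    (hImRow : ∀ r, Tendsto (fun N => loopImCov (fundamentalRep (Fin N)) (μ N) x (P.rowWord r) (P.rowWord r)) atTop (𝓝 0)) :
    ∀ δ > 0, ∀ᶠ N in atTop, P.obj (loopW (fundamentalRep (Fin N)) (μ N) x) ≤ P.bound + δ := by
  intro δ hδ
  have hprob' : ∀ᶠ N in atTop, IsProbabilityMeasure (μ N) := by
    filter_upwards [eventually_ge_atTop 1] with N hN; exact hprob N hN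
  -- the total defect and its limit
  set D : ℕ → ℝ := fun N => (∑ r, |P.rowMult r| * P.rowDefectSuN (μ N) x r) +
    ∑ s, P.shorDefect (fundamentalRep (Fin N)) (μ N) x s with hDdef
  have hD : Tendsto D atTop (𝓝 0) := by
    have h1 : Tendsto (fun N => ∑ r, |P.rowMult r| * P.rowDefectSuN (μ N) x r) atTop
        (𝓝 (∑ r : Fin P.nR, |P.rowMult r| * 0)) :=
      tendsto_finsetSum _ fun r _ => (tendsto_rowDefectSuN_zero P μ hprob' x r (hImRow r)).const_mul _
    have h2 : Tendsto (fun N => ∑ s, P.shorDefect (fundamentalRep (Fin N)) (μ N) x s) atTop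
        (𝓝 (∑ _s : Fin P.nS, (0 : ℝ))) :=
      tendsto_finsetSum _ fun s _ => tendsto_shorDefect_zero (fun N => fundamentalRep (Fin N))
        (fun N => continuous_fundamentalRep (Fin N)) μ P hprob' x hImShor s
    simp only [mul_zero, Finset.sum_const_zero] at h1 h2
    have h := h1.add h2
    rw [add_zero] at h
    exact h
  -- the finite-`N` bound
  have hle : ∀ᶠ N in atTop, P.obj (loopW (fundamentalRep (Fin N)) (μ N) x) ≤ P.bound + D N := by
    filter_upwards [eventually_ge_atTop 1] with N hN
    haveI := hprob N hN
    have h := P.obj_loopW_le_suN hP (natCast_mul_div_natCast hN P.βt) (hμ N hN) x hrow hgram (hlin N hN)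
    simpa [hDdef, add_assoc] using h
  have hDδ : ∀ᶠ N in atTop, D N < δ := (tendsto_order.1 hD).2 δ hδ
  filter_upwards [hle, hDδ] with N h1 h2
  linarith

/-- ★★ **Hence every limit of the finite-`N` values obeys the planar bound** (`SU(N)`): under the
hypotheses of `eventually_obj_le_suN`, if `obj(W_{μ_N}) → L` then `L ≤ bound`. [folklore] -/
theorem le_bound_of_tendsto_suN (hP : P.IsValid)
    (μ : (N : ℕ) → Measure (LGConfig d (Matrix.specialUnitaryGroup (Fin N) ℂ)))
    (hprob : ∀ N, 1 ≤ N → IsProbabilityMeasure (μ N))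
    (hμ : ∀ N, 1 ≤ N → IsHaarShiftState (fundamentalRep (Fin N)) ((N : ℝ) * P.βt) (μ N)) (x : Site d)
    (hrow : ∀ r, Word.endpointZd x (P.rowWord r) = x) (hgram : ∀ j i, Word.endpointZd x (P.gramWord j i) = x)
    (hlin : ∀ N, 1 ≤ N → ∀ e, P.lin e (loopW (fundamentalRep (Fin N)) (μ N) x) (loopQ (fundamentalRep (Fin N)) (μ N) x) = 0)
    (hImShor : ∀ A, Tendsto (fun N => loopImCov (fundamentalRep (Fin N)) (μ N) x (P.shorLoop A) (P.shorLoop A)) atTop (𝓝 0))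
    (hImRow : ∀ r, Tendsto (fun N => loopImCov (fundamentalRep (Fin N)) (μ N) x (P.rowWord r) (P.rowWord r)) atTop (𝓝 0))
    {L : ℝ} (hL : Tendsto (fun N => P.obj (loopW (fundamentalRep (Fin N)) (μ N) x)) atTop (𝓝 L)) :
    L ≤ P.bound := by
  refine le_of_forall_pos_le_add fun δ hδ => ?_
  exact le_of_tendsto hL (P.eventually_obj_le_suN hP μ hprob hμ x hrow hgram hlin hImShor hImRow δ hδ)

/-- ★★★ **THE CONDITIONAL LARGE-`N` THEOREM, `U(N)`** (no row defects: only the relaxation loops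
need to concentrate): with `μ_N` probability Haar-shift states of the `U(N)` Wilson action at tree
coupling `N·βt` satisfying the identification rows, if `E_{μ_N}[(Im t_{ℓ_A})²] → 0` for the loops
of the relaxation block then `obj(W_{μ_N}) ≤ bound + δ` eventually, every `δ > 0`. [folklore] -/
theorem eventually_obj_le_uN (hP : P.IsValid)
    (μ : (N : ℕ) → Measure (LGConfig d (Matrix.unitaryGroup (Fin N) ℂ)))
    (hprob : ∀ N, 1 ≤ N → IsProbabilityMeasure (μ N))
    (hμ : ∀ N, 1 ≤ N → IsHaarShiftState (unitaryFundamentalRep (Fin N) ℂ) ((N : ℝ) * P.βt) (μ N)) (x : Site d)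
    (hrow : ∀ r, Word.endpointZd x (P.rowWord r) = x) (hgram : ∀ j i, Word.endpointZd x (P.gramWord j i) = x)
    (hlin : ∀ N, 1 ≤ N → ∀ e,
      P.lin e (loopW (unitaryFundamentalRep (Fin N) ℂ) (μ N) x) (loopQ (unitaryFundamentalRep (Fin N) ℂ) (μ N) x) = 0)
    (hImShor : ∀ A, Tendsto (fun N => loopImCov (unitaryFundamentalRep (Fin N) ℂ) (μ N) x (P.shorLoop A) (P.shorLoop A))
      atTop (𝓝 0)) :
    ∀ δ > 0, ∀ᶠ N in atTop, P.obj (loopW (unitaryFundamentalRep (Fin N) ℂ) (μ N) x) ≤ P.bound + δ := by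
  intro δ hδ
  have hprob' : ∀ᶠ N in atTop, IsProbabilityMeasure (μ N) := by
    filter_upwards [eventually_ge_atTop 1] with N hN; exact hprob N hN
  set D : ℕ → ℝ := fun N => ∑ s, P.shorDefect (unitaryFundamentalRep (Fin N) ℂ) (μ N) x s with hDdef
  have hD : Tendsto D atTop (𝓝 0) := by
    have h2 : Tendsto (fun N => ∑ s, P.shorDefect (unitaryFundamentalRep (Fin N) ℂ) (μ N) x s) atTop
        (𝓝 (∑ _s : Fin P.nS, (0 : ℝ))) :=
      tendsto_finsetSum _ fun s _ => tendsto_shorDefect_zero (fun N => unitaryFundamentalRep (Fin N) ℂ)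
        (fun N => continuous_unitaryFundamentalRep (Fin N) ℂ) μ P hprob' x hImShor s
    simp only [Finset.sum_const_zero] at h2
    exact h2
  have hle : ∀ᶠ N in atTop, P.obj (loopW (unitaryFundamentalRep (Fin N) ℂ) (μ N) x) ≤ P.bound + D N := by
    filter_upwards [eventually_ge_atTop 1] with N hN
    haveI := hprob N hN
    exact P.obj_loopW_le_uN hP (natCast_mul_div_natCast hN P.βt) (hμ N hN) x hrow hgram (hlin N hN)
  have hDδ : ∀ᶠ N in atTop, D N < δ := (tendsto_order.1 hD).2 δ hδ
  filter_upwards [hle, hDδ] with N h1 h2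
  linarith

/-- ★★ Every limit of the finite-`N` `U(N)` values obeys the planar bound, under the hypotheses of
`eventually_obj_le_uN`. [folklore] -/
theorem le_bound_of_tendsto_uN (hP : P.IsValid)
    (μ : (N : ℕ) → Measure (LGConfig d (Matrix.unitaryGroup (Fin N) ℂ)))
    (hprob : ∀ N, 1 ≤ N → IsProbabilityMeasure (μ N))
    (hμ : ∀ N, 1 ≤ N → IsHaarShiftState (unitaryFundamentalRep (Fin N) ℂ) ((N : ℝ) * P.βt) (μ N)) (x : Site d)
    (hrow : ∀ r, Word.endpointZd x (P.rowWord r) = x) (hgram : ∀ j i, Word.endpointZd x (P.gramWord j i) = x)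
    (hlin : ∀ N, 1 ≤ N → ∀ e,
      P.lin e (loopW (unitaryFundamentalRep (Fin N) ℂ) (μ N) x) (loopQ (unitaryFundamentalRep (Fin N) ℂ) (μ N) x) = 0)
    (hImShor : ∀ A, Tendsto (fun N => loopImCov (unitaryFundamentalRep (Fin N) ℂ) (μ N) x (P.shorLoop A) (P.shorLoop A))
      atTop (𝓝 0))
    {L : ℝ} (hL : Tendsto (fun N => P.obj (loopW (unitaryFundamentalRep (Fin N) ℂ) (μ N) x)) atTop (𝓝 L)) :
    L ≤ P.bound := by
  refine le_of_forall_pos_le_add fun δ hδ => ?_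
  exact le_of_tendsto hL (P.eventually_obj_le_uN hP μ hprob hμ x hrow hgram hlin hImShor δ hδ)

end PlanarCertificate

end Summit.QuantumFields.GaugeBoot

end
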